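import Summits.MatrixMultiplication.OmegaCensus.STPPKernelListerReal
import Summits.MatrixMultiplication.OmegaCensus.STPPAlignedOrderThreeClash
import Summits.MatrixMultiplication.OmegaCensus.STPPAlignedInvolutionClashUnique
import Summits.MatrixMultiplication.OmegaCensus.STPPNearPeriodFilter

/-!
# ω-census (abelian STPP census): the tree's card-vector filters N20 / N19 / N19U / N11 as `¬ Realizable` bridges for the kernel lister's dead lists (kernel)

HONEST FRAMING (pub-omega census; verbatim): lottery ticket; floor = certified bounds/negative ranges.
Census STRUCTURE (seat pub-omega-stpp-2 gen 31, 2026-08-29), family (b2).  The kernel lister (`STPPKernelListerDefs.lean`) prunes with the laws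
N2 / N9 / N7 / N16 / N8 / N18 / N12 only; the tree ALSO has the per-pattern `decide` filters N20 (aligned order-three clash, `STPPAlignedOrderThreeClash.lean`),
N19 (aligned involution clash, `4 ∤ |H|`, `STPPAlignedInvolutionClash.lean`), N19U (the same for `ZMod n`, `…Unique.lean`) and N11 (near-period,
`STPPNearPeriodFilter.lean`), each with an `H`-generic front end `not_isSTPP_of_n??Dead'`.  This file turns them into one-line discharges of dead-list entries
of the conditional order capstones `KLister.volume_le_of_card_eq_<n>_of_dead`: `notRealizable_of_n20Dead` etc. — `¬ Realizable H P` from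
`N??Dead n P.length (sizes of P) = true` (decided per pattern).  DATUM (farm `decide` over every dead-list entry of orders 33–58, this seat): N20 kills both
entries at order 33 (⇒ order 33 unconditional, `STPPKernelListerOrderN33.lean`), 3/14 at 48, 3/15 at 51, 39/97 at 57; N19 kills 2/5 at 46, 7/54 at 54,
10/35 at 58; N11 kills 1 at 55.  Nothing here is progress on `ω`.

References: M. Kneser, Math. Z. 58 (1953); H. Cohn, R. Kleinberg, B. Szegedy, C. Umans, FOCS 2005 (arXiv:math/0511460), Def. 5.1.
-/

open Finset

namespace Summit.MatrixMultiplication.OmegaCensus.KLister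

open Literature.Computability.AlgebraicComplexity
open Summit.MatrixMultiplication.OmegaCensus.CubeNB

variable {H : Type*} [AddCommGroup H] [Fintype H] [DecidableEq H]

omit [AddCommGroup H] [Fintype H] [DecidableEq H] in
/-- The block sizes of a realised pattern are positive. [folklore] -/
theorem Realizable.sizes_pos {P : List Shape} {A B C : Fin P.length → Finset H}
    (hc : ∀ i, (A i).Nonempty ∧ (B i).Nonempty ∧ (C i).Nonempty ∧ #(A i) = (P.get i).1 ∧ #(B i) = (P.get i).2.1 ∧ #(C i) = (P.get i).2.2) :
    ∀ i, 0 < (P.get i).1 ∧ 0 < (P.get i).2.1 ∧ 0 < (P.get i).2.2 := fun i =>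
  ⟨(hc i).2.2.2.1 ▸ card_pos.2 (hc i).1, (hc i).2.2.2.2.1 ▸ card_pos.2 (hc i).2.1, (hc i).2.2.2.2.2 ▸ card_pos.2 (hc i).2.2.1⟩

/-- **N20 bridge**: a pattern whose card vector is `N20Dead` at `|H|` is not realisable in `H`. [cite: Kneser1953] [cite: CohnKleinbergSzegedyUmans2005, Def. 5.1] -/
theorem notRealizable_of_n20Dead {n : ℕ} (hH : Fintype.card H = n) (P : List Shape)
    (h : N20Dead n P.length (fun i => (P.get i).1) (fun i => (P.get i).2.1) (fun i => (P.get i).2.2) = true) : ¬ Realizable H P := by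
  intro hR
  obtain ⟨A, B, C, hS, hc⟩ := hR.out
  exact not_isSTPP_of_n20Dead' hS hH _ _ _ (fun i => (hc i).2.2.2.1) (fun i => (hc i).2.2.2.2.1) (fun i => (hc i).2.2.2.2.2)
    (Realizable.sizes_pos hc) h

/-- **N19 bridge**: a pattern whose card vector is `N19Dead` at `|H|` is not realisable in `H`. [cite: Kneser1953] [cite: CohnKleinbergSzegedyUmans2005, Def. 5.1] -/
theorem notRealizable_of_n19Dead {n : ℕ} (hH : Fintype.card H = n) (P : List Shape)
    (h : N19Dead n P.length (fun i => (P.get i).1) (fun i => (P.get i).2.1) (fun i => (P.get i).2.2) = true) : ¬ Realizable H P := by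
  intro hR
  obtain ⟨A, B, C, hS, hc⟩ := hR.out
  exact not_isSTPP_of_n19Dead' hS hH _ _ _ (fun i => (hc i).2.2.2.1) (fun i => (hc i).2.2.2.2.1) (fun i => (hc i).2.2.2.2.2)
    (Realizable.sizes_pos hc) h

/-- **N11 bridge**: a pattern whose card vector is `N11Dead` at `|H|` is not realisable in `H`. [cite: Kneser1953] [cite: CohnKleinbergSzegedyUmans2005, Def. 5.1] -/
theorem notRealizable_of_n11Dead {n : ℕ} (hH : Fintype.card H = n) (P : List Shape)
    (h : N11Dead n P.length (fun i => (P.get i).1) (fun i => (P.get i).2.1) (fun i => (P.get i).2.2) = true) : ¬ Realizable H P := by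
  intro hR
  obtain ⟨A, B, C, hS, hc⟩ := hR.out
  exact not_isSTPP_of_n11Dead' hS hH _ _ _ (fun i => (hc i).2.2.2.1) (fun i => (hc i).2.2.2.2.1) (fun i => (hc i).2.2.2.2.2)
    (Realizable.sizes_pos hc) h

/-- **N19U bridge (cyclic groups)**: a pattern whose card vector is `N19UDead` at `n` is not realisable in `ZMod n`. [cite: Kneser1953] [cite: CohnKleinbergSzegedyUmans2005, Def. 5.1] -/
theorem notRealizable_zmod_of_n19UDead {n : ℕ} [NeZero n] (P : List Shape)
    (h : N19UDead n P.length (fun i => (P.get i).1) (fun i => (P.get i).2.1) (fun i => (P.get i).2.2) = true) : ¬ Realizable (ZMod n) P := by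
  intro hR
  obtain ⟨A, B, C, hS, hc⟩ := hR.out
  exact not_isSTPP_zmod_of_n19UDead' hS _ _ _ (fun i => (hc i).2.2.2.1) (fun i => (hc i).2.2.2.2.1) (fun i => (hc i).2.2.2.2.2)
    (Realizable.sizes_pos hc) h

end Summit.MatrixMultiplication.OmegaCensus.KLister
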